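import Literature.AnabelianGeometry.SemiGraphs.TemperedGaloisCountableOfStrictlyCoherent
import Literature.AnabelianGeometry.SemiGraphs.CoveringGraphHypothesesBasic
import Literature.AnabelianGeometry.SemiGraphs.MorphismsOver
import Mathlib.GroupTheory.Schreier
import HarnessLib

/-!
# Strict coherence and Galois-countability of covering semi-graphs of anabelioids (route T, T7d)

Mochizuki, *Inter-universal Teichmüller theory I*, Remark 2.5.3 (i) (T3)/(T4) p. 53
[cite: Mochizuki2012, IUTchI Rem. 2.5.3(i)(T3) p.53] over *Semi-graphs of anabelioids*, Publ. RIMS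
**42** (2006), §3 Def. 3.5 (i) p. 37 (the covering semi-graph of anabelioids `G_S → G` of an object
`S` of `B^cov(G)`, `CovObj.coveringGraph`) [cite: MochizukiSemiAnbd2006, Def 3.5(i) p.37].

The constituents of `G_S` are OPEN stabilisers `Stab_{Π_c}(s) ⊆ Π_c`; for `S` tempered and connected
over a connected `G` their indices are bounded by the (constant) degree `D` of one finite étale covering
splitting `S` (`exists_index_stab_le`).  Hence:

* `Subgroup.exists_finset_card_le_mul_of_dense` — SCHREIER for dense subgroups: an open subgroup of
  index `≤ d` of a compact group topologically generated by `N` elements is topologically generated by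
  `d · N` elements (Mathlib's `Subgroup.exists_finset_card_le_mul` inside the dense finitely generated
  subgroup);
* `isStrictlyCoherent_coveringGraph_of_isQuasiCoherent` — if `G` is strictly coherent, the indices
  of the constituents of `G_S` are uniformly bounded, and `G_S` is quasi-coherent (hereditary
  quasi-coherence is the companion brick T7c, taken here BY NAME as a hypothesis), then `G_S` is
  strictly coherent;
* `isGaloisCountable_coveringGraph_of_isQuasiCoherent` — (T2) for `G_S`: by [IUTchI] Rmk. 2.5.3 (i)
  (T4) (`isGaloisCountable_of_isStrictlyCoherent`) from the above and the easy hereditary hypotheses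
  (`CoveringGraphHypothesesBasic`, brick T7a).

Proof-only (abc-iut cell, L3 route T, brick T7d core; seat abc-iut-L3-d6); no definition, no
statement of the paper retyped; nothing here bears on [IUTchIII] Cor. 3.12.
-/

open CategoryTheory Topology

/-! ### Schreier's bound for dense finitely generated subgroups -/

namespace Subgroup

variable {G : Type*} [Group G] [TopologicalSpace G] [IsTopologicalGroup G] [CompactSpace G]

/-- **Schreier's index formula, topological form**: if the compact group `G` is topologically
generated by the finset `s` and `V` is an open subgroup of index `≤ d`, then `V` is topologically
generated by at most `d · |s|` elements (Schreier's lemma `exists_finset_card_le_mul` for the trace of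
`V` on the dense finitely generated subgroup `⟨s⟩`, whose image is dense in the open `V`).
[cite: DDMSAnalyticProP1999, Thm 1.17 (proof)] -/
theorem exists_finset_card_le_mul_of_dense (s : Finset G)
    (hs : (closure (s : Set G)).topologicalClosure = ⊤) (V : Subgroup G) (hV : IsOpen (V : Set G)) :
    ∃ t : Finset V, t.card ≤ V.index * s.card ∧
      (closure (t : Set V)).topologicalClosure = ⊤ := by
  classical
  set D : Subgroup G := closure (s : Set G) with hD
  have hdense : Dense (D : Set G) := by
    rw [dense_iff_closure_eq, ← Subgroup.topologicalClosure_coe, hs, coe_top]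
  haveI : Finite (G ⧸ V) := quotient_finite_of_isOpen V hV
  haveI hVfi : V.FiniteIndex := finiteIndex_of_finite_quotient
  -- the trace `W = D ∩ V` of `V` on `D`, of index `≤ [G : V]`
  set W : Subgroup D := V.subgroupOf D with hW
  have hWi : W.index ≤ V.index := by
    change V.relIndex D ≤ V.index
    rw [← relIndex_top_right]
    exact relIndex_le_of_le_right le_top (by rw [relIndex_top_right]; exact hVfi.index_ne_zero)
  have hWi0 : W.index ≠ 0 := by
    change V.relIndex D ≠ 0
    exact fun h => hVfi.index_ne_zero (index_eq_zero_of_relIndex_eq_zero h)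
  haveI : W.FiniteIndex := ⟨hWi0⟩
  -- `s` generates `D` abstractly
  let sD : Finset D := s.subtype (· ∈ D)
  have hsD : closure (sD : Set D) = ⊤ := by
    have : (sD : Set D) = ((↑) : D → G) ⁻¹' (s : Set G) := by
      ext x
      simp [sD, Finset.mem_subtype]
    rw [this]
    exact closure_closure_coe_preimage
  have hsDcard : sD.card ≤ s.card :=
    Finset.card_le_card_of_injOn (fun x : D => (x : G)) (fun x hx => by simpa [sD] using hx)
      (Subtype.val_injective.injOn)
  -- Schreier inside `D`
  obtain ⟨T, hTcard, hT⟩ := exists_finset_card_le_mul (H := W) hsD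
  -- push into `V`
  let φ : W →* V := (D.subtype.comp W.subtype).codRestrict V fun w => mem_subgroupOf.mp w.2
  refine ⟨T.image φ, ?_, ?_⟩
  · calc (T.image φ).card ≤ T.card := Finset.card_image_le
      _ ≤ W.index * sD.card := hTcard
      _ ≤ V.index * s.card := Nat.mul_le_mul hWi hsDcard
  · rw [SetLike.ext'_iff, Subgroup.topologicalClosure_coe, coe_top, ← dense_iff_closure_eq,
      Subtype.dense_iff]
    intro v hv
    have h1 : (V : Set G) ⊆ _root_.closure ((V : Set G) ∩ D) := hdense.open_subset_closure_inter hV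
    refine _root_.closure_mono ?_ (h1 hv)
    rintro g ⟨hgV, hgD⟩
    let w : W := ⟨⟨g, hgD⟩, mem_subgroupOf.mpr hgV⟩
    have hw : w ∈ closure (T : Set W) := by rw [hT]; exact mem_top w
    have hφw : φ w ∈ closure ((T.image φ : Finset V) : Set V) := by
      rw [Finset.coe_image, ← MonoidHom.map_closure]
      exact mem_map_of_mem φ hw
    exact ⟨φ w, hφw, rfl⟩

end Subgroup

namespace Literature.AnabelianGeometry.SemiGraphs

namespace ProfiniteSemiGraph

namespace CovObj

open Literature.AlgebraicGeometry.Frobenioids (IsConnectedObj)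

universe u

variable {𝒢 : ProfiniteSemiGraph.{u}} (S : CovObj 𝒢)

/-! ### Uniform index bound for the constituents of `G_S` -/

/-- For `S` tempered and connected over a connected `G`, the open stabilisers `Stab_{Π_v}(s)`,
`Stab_{Π_e}(s)` — the constituent groups of `G_S` — have finite index bounded UNIFORMLY by the degree
of one finite étale covering splitting `S` (Def. 3.5 (ii): the stabiliser of `s` contains the
stabiliser of a point of the splitting covering, whose fibres have constant cardinality on the
connected `G`). [cite: MochizukiSemiAnbd2006, Def 3.5(ii) p.37] -/
theorem exists_index_stab_le (hconn : 𝒢.IsConnected) (hS : S.IsTempered)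
    (hSc : IsConnectedObj (⟨S, hS⟩ : BTempCat 𝒢)) :
    ∃ D : ℕ, (∀ (v : 𝒢.graph.Vertex) (s : (S.SV v).obj.V),
        (BTemp.stab (S.SV v) s).index ≠ 0 ∧ (BTemp.stab (S.SV v) s).index ≤ D) ∧
      ∀ (e : 𝒢.graph.Edge) (s : (S.SE e).obj.V),
        (BTemp.stab (S.SE e) s).index ≠ 0 ∧ (BTemp.stab (S.SE e) s).index ≤ D := by
  obtain ⟨p⟩ := nonempty_point_of_isConnectedObj ⟨S, hS⟩ hSc
  obtain ⟨F₀, h0fin, h0ne, h0split⟩ := hS p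
  haveI : ∀ v, Finite (F₀.SV v).obj.V := h0fin.finite_V
  haveI : ∀ e, Finite (F₀.SE e).obj.V := h0fin.finite_E
  obtain ⟨n₀⟩ := hconn.connected.nonempty
  refine ⟨F₀.nodeCard n₀, fun v s => ?_, fun e s => ?_⟩
  · obtain ⟨x₀⟩ := h0ne.nonempty_V v
    have h := index_stab_le (X := S.SV v) x₀ s
      (h0split (Sum.inl ⟨v, s⟩) (sameComponent_of_isConnectedObj ⟨S, hS⟩ hSc p _))
    have hD : Nat.card (F₀.SV v).obj.V = F₀.nodeCard n₀ :=
      F₀.nodeCard_eq_of_reachable (hconn.connected.preconnected (Sum.inl v) n₀)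
    exact ⟨h.1, hD ▸ h.2⟩
  · obtain ⟨x₀⟩ := h0ne.nonempty_E e
    have h := index_stab_le (X := S.SE e) x₀ s
      (h0split (Sum.inr ⟨e, s⟩) (sameComponent_of_isConnectedObj ⟨S, hS⟩ hSc p _))
    have hD : Nat.card (F₀.SE e).obj.V = F₀.nodeCard n₀ :=
      F₀.nodeCard_eq_of_reachable (hconn.connected.preconnected (Sum.inr (Sum.inl e)) n₀)
    exact ⟨h.1, hD ▸ h.2⟩

/-! ### Strict coherence of `G_S` -/

/-- **`G_S` is strictly coherent** when `G` is strictly coherent ([IUTchI] Rmk. 2.5.3 (i) (T3)), the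
constituents of `G_S` have indices `≤ d` in those of `G`, and `G_S` is quasi-coherent: every
`Π_{(c,ω)} = Stab_{Π_c}(s_ω)` is an open subgroup of index `≤ d` of a topologically `N`-generated
compact group, hence topologically `(d · N)`-generated (Schreier).
[cite: Mochizuki2012, IUTchI Rem. 2.5.3(i)(T3) p.53] -/
theorem isStrictlyCoherent_coveringGraph_of_isQuasiCoherent (hsc : 𝒢.IsStrictlyCoherent)
    (hq : S.coveringGraph.IsQuasiCoherent) {d : ℕ}
    (hdV : ∀ (v : 𝒢.graph.Vertex) (s : (S.SV v).obj.V), (BTemp.stab (S.SV v) s).index ≤ d)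
    (hdE : ∀ (e : 𝒢.graph.Edge) (s : (S.SE e).obj.V), (BTemp.stab (S.SE e) s).index ≤ d) :
    S.coveringGraph.IsStrictlyCoherent := by
  classical
  obtain ⟨N, hN1, hgenV, hgenE⟩ := hsc.exists_bound
  have hV : ∀ v' : S.coveringGraph.graph.Vertex, ∃ t : Finset (S.coveringGraph.Gv v'),
      t.card ≤ max 1 (d * N) ∧
        (Subgroup.closure (t : Set (S.coveringGraph.Gv v'))).topologicalClosure = ⊤ := by
    rintro ⟨v, ω⟩
    obtain ⟨s, hs, hgen⟩ := hgenV v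
    obtain ⟨t, htcard, ht⟩ := Subgroup.exists_finset_card_le_mul_of_dense s hgen
      (BTemp.stab (S.SV v) (Quot.out ω)) ((S.SV v).property.2 _)
    refine ⟨t, htcard.trans ?_, ht⟩
    exact (Nat.mul_le_mul (hdV v _) hs).trans (le_max_right _ _)
  have hE : ∀ e' : S.coveringGraph.graph.Edge, ∃ t : Finset (S.coveringGraph.Ge e'),
      t.card ≤ max 1 (d * N) ∧
        (Subgroup.closure (t : Set (S.coveringGraph.Ge e'))).topologicalClosure = ⊤ := by
    rintro ⟨e, ω⟩
    obtain ⟨s, hs, hgen⟩ := hgenE e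
    obtain ⟨t, htcard, ht⟩ := Subgroup.exists_finset_card_le_mul_of_dense s hgen
      (BTemp.stab (S.SE e) (Quot.out ω)) ((S.SE e).property.2 _)
    refine ⟨t, htcard.trans ?_, ht⟩
    exact (Nat.mul_le_mul (hdE e _) hs).trans (le_max_right _ _)
  exact ⟨⟨hq, fun v' => (hV v').imp fun t ht => ht.2, fun e' => (hE e').imp fun t ht => ht.2⟩,
    ⟨max 1 (d * N), le_max_left _ _, hV, hE⟩⟩

/-- **`G_S` is strictly coherent** for `G` connected and strictly coherent and `S` tempered and
connected — given the hereditary quasi-coherence of `G_S` (brick T7c) by name.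
[cite: Mochizuki2012, IUTchI Rem. 2.5.3(i)(T3) p.53] -/
theorem isStrictlyCoherent_coveringGraph_of_isQuasiCoherent' (hconn : 𝒢.IsConnected)
    (hsc : 𝒢.IsStrictlyCoherent) (hS : S.IsTempered)
    (hSc : IsConnectedObj (⟨S, hS⟩ : BTempCat 𝒢)) (hq : S.coveringGraph.IsQuasiCoherent) :
    S.coveringGraph.IsStrictlyCoherent := by
  obtain ⟨D, hDV, hDE⟩ := S.exists_index_stab_le hconn hS hSc
  exact S.isStrictlyCoherent_coveringGraph_of_isQuasiCoherent hsc hq (fun v s => (hDV v s).2)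
    fun e s => (hDE e s).2

/-! ### `G_S` has a vertex -/

/-- Over a connected `G` with at least one vertex, a connected object of `B^temp(G)` has a nonempty
vertex fibre, i.e. `G_S` has a vertex (a point of an edge fibre is glued to a vertex point along an
abutting branch, which exists by connectedness). [cite: MochizukiSemiAnbd2006, Def 3.5(i) p.37] -/
theorem hasVertex_coveringGraph_of_isConnectedObj (hconn : 𝒢.IsConnected) (hv : 𝒢.HasVertex)
    (hS : S.IsTempered) (hSc : IsConnectedObj (⟨S, hS⟩ : BTempCat 𝒢)) :
    S.coveringGraph.HasVertex := by
  obtain ⟨p⟩ := nonempty_point_of_isConnectedObj ⟨S, hS⟩ hSc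
  rcases p with ⟨v, x⟩ | ⟨e, y⟩
  · exact S.hasVertex_coveringGraph x
  · obtain ⟨v₀⟩ := hv
    obtain ⟨b, hbe, hb⟩ := SemiGraph.exists_abuts_of_isConnected hconn v₀ e
    obtain ⟨v, hbv⟩ := Option.isSome_iff_exists.mp hb
    subst hbe
    exact S.hasVertex_coveringGraph ((S.glue b v hbv).hom.hom.hom y)

/-! ### (T2) Galois-countability of `G_S` -/

/-- **`G_S` is Galois-countable** ([IUTchI] Rmk. 2.5.3 (i) (T2)) for `G` connected, countable,
strictly coherent with a vertex and `S` tempered and connected, given the hereditary quasi-coherence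
of `G_S` (brick T7c) by name: `G_S` is then connected, countable, strictly coherent with a vertex, and
(T4) applies (`isGaloisCountable_of_isStrictlyCoherent`).
[cite: Mochizuki2012, IUTchI Rem. 2.5.3(i)(T4) p.53] -/
theorem isGaloisCountable_coveringGraph_of_isQuasiCoherent (hconn : 𝒢.IsConnected)
    (hv : 𝒢.HasVertex) (hcnt : 𝒢.IsCountable) (hsc : 𝒢.IsStrictlyCoherent) (hS : S.IsTempered)
    (hSc : IsConnectedObj (⟨S, hS⟩ : BTempCat 𝒢)) (hq : S.coveringGraph.IsQuasiCoherent) :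
    S.coveringGraph.IsGaloisCountable :=
  isGaloisCountable_of_isStrictlyCoherent (S.isConnected_coveringGraph hS hSc)
    (S.hasVertex_coveringGraph_of_isConnectedObj hconn hv hS hSc) (S.isCountable_coveringGraph hcnt)
    (S.isStrictlyCoherent_coveringGraph_of_isQuasiCoherent' hconn hsc hS hSc hq)

/-- The same from the bundled hypotheses of Prop. 3.6. [cite: Mochizuki2012, IUTchI Rem. 2.5.3(i)(T4) p.53] -/
theorem isGaloisCountable_coveringGraph_of_isQuasiCoherent' (h36 : 𝒢.Prop36Hypotheses)
    (hsc : 𝒢.IsStrictlyCoherent) (hS : S.IsTempered)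
    (hSc : IsConnectedObj (⟨S, hS⟩ : BTempCat 𝒢)) (hq : S.coveringGraph.IsQuasiCoherent) :
    S.coveringGraph.IsGaloisCountable :=
  S.isGaloisCountable_coveringGraph_of_isQuasiCoherent h36.isConnected h36.hasVertex h36.isCountable
    hsc hS hSc hq

end CovObj

end ProfiniteSemiGraph

end Literature.AnabelianGeometry.SemiGraphs
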